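import Mathlib
import Summits.Ventures.PercRepro2.Defs
import Summits.Ventures.PercRepro2.Harris
import Summits.Ventures.PercRepro2.Independence
import Summits.Ventures.PercRepro2.CoinDefs
import Summits.Ventures.PercRepro2.CoinReverse
import Summits.Ventures.PercRepro2.CoinStarDefs
import Summits.Ventures.PercRepro2.CoinLsmCoreDefs
import Summits.Ventures.PercRepro2.CoinLsmCoreU
import Summits.Ventures.PercRepro2.CoinCoreGate
import Summits.Ventures.PercRepro2.CoinTreeCore
import Summits.Ventures.PercRepro2.CoinDiamondAlg
import Summits.Ventures.PercRepro2.CoinOrTailAlg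
import Summits.Ventures.PercRepro2.CoinOrTailDefs

/-!
# Row 2′DARC at the OR-TAIL over TWO INDEPENDENT LOG-SUPERMODULAR BRANCHES, at every head
(blind cell PercRepro2, night-2 g9; proofs/NIGHT2-DARC.md §35)

`darc_of_orTailCore`: on a mixed coin system whose closed-in core is an OR-tail core
`B₁ ∪ B₂ ∪ {a}` (`OrTailCore`: two disjoint closed-in branches `B₁ ∋ p`, `B₂ ∋ q` below `s`, the
tail `a` entered only by `p → a` and `q → a`) whose two BRANCH cluster laws are log-supermodular,
row 2′DARC holds at the arc `a → w` for the markers `p, q` and EVERY head.  This is the directed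
diamond (`darc_of_diamondCore`, branches = single vertices) over a general lsm «root»: the seven
core sums of `ClosedInCoreU.phiC_gate_eq` factorise through the branch levels
(`OrTailCore.prob_coreLevel_eq`) into the seven moments of `orTail_functional_nonneg`, which is
the diamond certificate on the cell-averaged head values (Ahlswede–Daykin).  Instances: every
directed two-route core `s → p₁ → … → p_k → a ← q_l ← … ← q₁ ← s` with the markers ADJACENT to
the tail (any `k, l ≥ 1`), and more generally any two out-tree branches (`darc_of_orTailTrees`,
via `TreeCore.coreLevel_lsm`).  No non-degeneracy hypothesis.
-/

namespace Summit.Ventures.PercRepro2.Coin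

open Classical

section OrTailMain

variable {V : Type*} {E : Type*} [Fintype V] [DecidableEq V] [Fintype E] [DecidableEq E]
  {R : Type*} [Field R] [LinearOrder R] [IsStrictOrderedRing R]
  {arcs : E → Finset (V × V)} {s : V} {B₁ B₂ : Finset V} {p q a w : V} {cρ cτ : E}

omit [Fintype V] [LinearOrder R] [IsStrictOrderedRing R] in
/-- The `R`-side core sum over `B₁ ∪ B₂ ∪ {a}` with a marker constant in `a` is the branch sum
of `rVal`. -/
lemma OrTailCore.sum_R_eq (h : OrTailCore arcs s B₁ B₂ p q a cρ cτ) (hS : SameEnds arcs)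
    (pr : E → R) (t : V) (m : Finset V → R) (hm : ∀ W, m (insert a W) = m W) :
    ∑ W ∈ (insert a (B₁ ∪ B₂)).powerset, prob pr (coreLevel arcs s (insert a (B₁ ∪ B₂)) W) *
        prob pr (coreAvoidEvent arcs s t (insert a (B₁ ∪ B₂)) W) * m W =
      ∑ W ∈ (B₁ ∪ B₂).powerset,
        (prob pr (coreLevel arcs s B₁ (W ∩ B₁)) * prob pr (coreLevel arcs s B₂ (W ∩ B₂))) *
          rVal (fun X => prob pr (coreAvoidEvent arcs s t (insert a (B₁ ∪ B₂)) X)) p q a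
            (pr cρ) (pr cτ) W * m W := by
  rw [Finset.sum_powerset_insert h.a_notin, ← Finset.sum_add_distrib]
  refine Finset.sum_congr rfl fun W hW => ?_
  have haW : a ∉ W := fun haW => h.a_notin (Finset.mem_powerset.1 hW haW)
  have hins : insert a W = W ∪ {a} := by rw [Finset.insert_eq, Finset.union_comm]
  rw [h.prob_coreLevel_eq hS pr W, h.prob_coreLevel_eq hS pr (insert a W),
    prob_tailEvent pr h.ρτ_ne W, prob_tailEvent pr h.ρτ_ne (insert a W), hm W,
    Finset.insert_inter_of_notMem h.a_notin₁, Finset.insert_inter_of_notMem h.a_notin₂]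
  simp only [rVal, tailWt, Finset.mem_insert, haW, h.p_ne_a, h.q_ne_a, false_or, if_false,
    true_or, if_true]
  rw [hins]
  ring

omit [Fintype V] [LinearOrder R] [IsStrictOrderedRing R] in
/-- The gate-side core sum over `B₁ ∪ B₂ ∪ {a}` with a marker constant in `a` is the branch sum
of `gVal`. -/
lemma OrTailCore.sum_G_eq (h : OrTailCore arcs s B₁ B₂ p q a cρ cτ) (hS : SameEnds arcs)
    (pr : E → R) (t : V) (m : Finset V → R) (hm : ∀ W, m (insert a W) = m W) :
    ∑ W ∈ (insert a (B₁ ∪ B₂)).powerset, prob pr (coreLevel arcs s (insert a (B₁ ∪ B₂)) W) *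
        prob pr (coreAvoidEvent arcs s t (insert a (B₁ ∪ B₂)) (starTarget a w W)) * m W =
      ∑ W ∈ (B₁ ∪ B₂).powerset,
        (prob pr (coreLevel arcs s B₁ (W ∩ B₁)) * prob pr (coreLevel arcs s B₂ (W ∩ B₂))) *
          gVal (fun X => prob pr (coreAvoidEvent arcs s t (insert a (B₁ ∪ B₂)) X)) p q a w
            (pr cρ) (pr cτ) W * m W := by
  rw [Finset.sum_powerset_insert h.a_notin, ← Finset.sum_add_distrib]
  refine Finset.sum_congr rfl fun W hW => ?_
  have haW : a ∉ W := fun haW => h.a_notin (Finset.mem_powerset.1 hW haW)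
  have hsw : insert w (insert a W) = W ∪ {a, w} := by
    ext x
    simp only [Finset.mem_insert, Finset.mem_union, Finset.mem_singleton]
    tauto
  have hst1 : starTarget a w W = W := by simp [starTarget, haW]
  have hst2 : starTarget a w (insert a W) = W ∪ {a, w} := by
    simp only [starTarget, Finset.mem_insert_self, if_true]
    exact hsw
  rw [h.prob_coreLevel_eq hS pr W, h.prob_coreLevel_eq hS pr (insert a W),
    prob_tailEvent pr h.ρτ_ne W, prob_tailEvent pr h.ρτ_ne (insert a W), hm W,
    Finset.insert_inter_of_notMem h.a_notin₁, Finset.insert_inter_of_notMem h.a_notin₂,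
    hst1, hst2]
  simp only [gVal, tailWt, Finset.mem_insert, haW, h.p_ne_a, h.q_ne_a, false_or, if_false,
    true_or, if_true]
  ring

/-- **THEOREM (row 2′DARC at the OR-tail over two independent log-supermodular branches, every
head).**  Hypotheses: a mixed system (`SameEnds`), an OR-tail core `B₁ ∪ B₂ ∪ {a}`
(`OrTailCore`), the two branch cluster laws log-supermodular (`hν₁`, `hν₂`: for all
`W, W' ⊆ B_i`, `P(level W)·P(level W') ≤ P(level (W ∩ W'))·P(level (W ∪ W'))`),
`t, w ∉ B₁ ∪ B₂ ∪ {a, s}`.  Conclusion: `Φ_D({s ↛ t in D + (a → w)}) ≥ 0` for the markers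
`p, q`.  Nothing is assumed about the head (entries from `s`, the branches and `a` anywhere; any
mixed structure; `t` anywhere outside the core); no non-degeneracy hypothesis. -/
theorem darc_of_orTailCore (pr : E → R) (hp : IsProbVec pr) (hS : SameEnds arcs)
    (h : OrTailCore arcs s B₁ B₂ p q a cρ cτ)
    (hν₁ : ∀ W W', W ⊆ B₁ → W' ⊆ B₁ →
      prob pr (coreLevel arcs s B₁ W) * prob pr (coreLevel arcs s B₁ W') ≤
        prob pr (coreLevel arcs s B₁ (W ∩ W')) * prob pr (coreLevel arcs s B₁ (W ∪ W')))
    (hν₂ : ∀ W W', W ⊆ B₂ → W' ⊆ B₂ →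
      prob pr (coreLevel arcs s B₂ W) * prob pr (coreLevel arcs s B₂ W') ≤
        prob pr (coreLevel arcs s B₂ (W ∩ W')) * prob pr (coreLevel arcs s B₂ (W ∪ W')))
    {t : V} (htC : t ∉ insert a (B₁ ∪ B₂)) (hts : t ≠ s) (hws : w ≠ s)
    (hwC : w ∉ insert a (B₁ ∪ B₂)) :
    DARC pr arcs s {t} p q a w := by
  have hC := h.closedInCoreU
  have hpC : p ∈ insert a (B₁ ∪ B₂) := by simp [h.p_mem]
  have hqC : q ∈ insert a (B₁ ∪ B₂) := by simp [h.q_mem]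
  have haC : a ∈ insert a (B₁ ∪ B₂) := Finset.mem_insert_self _ _
  unfold DARC
  rw [hC.phiC_gate_eq pr hS htC hts hpC hqC haC hws hwC]
  -- the seven core sums as branch sums
  have hm1 : ∀ W : Finset V, (fun _ : Finset V => (1 : R)) (insert a W) = (fun _ => (1 : R)) W :=
    fun _ => rfl
  have hmp : ∀ W : Finset V, (fun W : Finset V => if p ∈ W then (1 : R) else 0) (insert a W) =
      (fun W : Finset V => if p ∈ W then (1 : R) else 0) W := by
    intro W; simp only [Finset.mem_insert, h.p_ne_a, false_or]
  have hmq : ∀ W : Finset V, (fun W : Finset V => if q ∈ W then (1 : R) else 0) (insert a W) =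
      (fun W : Finset V => if q ∈ W then (1 : R) else 0) W := by
    intro W; simp only [Finset.mem_insert, h.q_ne_a, false_or]
  have hmpq : ∀ W : Finset V,
      (fun W : Finset V => (if p ∈ W then (1 : R) else 0) * (if q ∈ W then (1 : R) else 0))
        (insert a W) =
      (fun W : Finset V => (if p ∈ W then (1 : R) else 0) * (if q ∈ W then (1 : R) else 0)) W := by
    intro W; simp only [Finset.mem_insert, h.p_ne_a, h.q_ne_a, false_or]
  have eΛ := h.sum_R_eq hS pr t (fun _ => (1 : R)) hm1
  have eFa := h.sum_R_eq hS pr t (fun W => if p ∈ W then (1 : R) else 0) hmp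
  have eFb := h.sum_R_eq hS pr t (fun W => if q ∈ W then (1 : R) else 0) hmq
  have eM := h.sum_G_eq (w := w) hS pr t (fun _ => (1 : R)) hm1
  have eX := h.sum_G_eq (w := w) hS pr t (fun W => if p ∈ W then (1 : R) else 0) hmp
  have eY := h.sum_G_eq (w := w) hS pr t (fun W => if q ∈ W then (1 : R) else 0) hmq
  have eXY := h.sum_G_eq (w := w) hS pr t
    (fun W => (if p ∈ W then (1 : R) else 0) * (if q ∈ W then (1 : R) else 0)) hmpq
  simp only [mul_one] at eΛ eM
  rw [eΛ, eFa, eFb, eM, eX, eY, eXY]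
  -- the abstract functional
  set U := B₁ ∪ B₂ with hU
  set A : Finset V → R := fun X => prob pr (coreAvoidEvent arcs s t (insert a U) X) with hA
  set ν : Finset V → R := fun W =>
    prob pr (coreLevel arcs s B₁ (W ∩ B₁)) * prob pr (coreLevel arcs s B₂ (W ∩ B₂)) with hν
  have haU : a ∉ U := h.a_notin
  have hwU : w ∉ U := fun hw => hwC (Finset.mem_insert_of_mem hw)
  have hν0 : ∀ W, 0 ≤ ν W := fun W => mul_nonneg (prob_nonneg hp _) (prob_nonneg hp _)
  have hνlsm : ∀ s' ⊆ U, ∀ t' ⊆ U, ν s' * ν t' ≤ ν (s' ∩ t') * ν (s' ∪ t') := by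
    intro s' _ t' _
    have e1 : (s' ∩ t') ∩ B₁ = (s' ∩ B₁) ∩ (t' ∩ B₁) := by
      ext x; simp only [Finset.mem_inter]; tauto
    have e2 : (s' ∩ t') ∩ B₂ = (s' ∩ B₂) ∩ (t' ∩ B₂) := by
      ext x; simp only [Finset.mem_inter]; tauto
    have e3 : (s' ∪ t') ∩ B₁ = (s' ∩ B₁) ∪ (t' ∩ B₁) := by
      ext x; simp only [Finset.mem_inter, Finset.mem_union]; tauto
    have e4 : (s' ∪ t') ∩ B₂ = (s' ∩ B₂) ∪ (t' ∩ B₂) := by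
      ext x; simp only [Finset.mem_inter, Finset.mem_union]; tauto
    have h1 := hν₁ (s' ∩ B₁) (t' ∩ B₁) Finset.inter_subset_right Finset.inter_subset_right
    have h2 := hν₂ (s' ∩ B₂) (t' ∩ B₂) Finset.inter_subset_right Finset.inter_subset_right
    simp only [hν, e1, e2, e3, e4]
    calc prob pr (coreLevel arcs s B₁ (s' ∩ B₁)) * prob pr (coreLevel arcs s B₂ (s' ∩ B₂)) *
          (prob pr (coreLevel arcs s B₁ (t' ∩ B₁)) * prob pr (coreLevel arcs s B₂ (t' ∩ B₂)))
        = (prob pr (coreLevel arcs s B₁ (s' ∩ B₁)) * prob pr (coreLevel arcs s B₁ (t' ∩ B₁))) *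
          (prob pr (coreLevel arcs s B₂ (s' ∩ B₂)) * prob pr (coreLevel arcs s B₂ (t' ∩ B₂))) := by
          ring
      _ ≤ (prob pr (coreLevel arcs s B₁ (s' ∩ B₁ ∩ (t' ∩ B₁))) *
            prob pr (coreLevel arcs s B₁ (s' ∩ B₁ ∪ t' ∩ B₁))) *
          (prob pr (coreLevel arcs s B₂ (s' ∩ B₂ ∩ (t' ∩ B₂))) *
            prob pr (coreLevel arcs s B₂ (s' ∩ B₂ ∪ t' ∩ B₂))) :=
          mul_le_mul h1 h2 (mul_nonneg (prob_nonneg hp _) (prob_nonneg hp _))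
            (mul_nonneg (prob_nonneg hp _) (prob_nonneg hp _))
      _ = prob pr (coreLevel arcs s B₁ (s' ∩ B₁ ∩ (t' ∩ B₁))) *
            prob pr (coreLevel arcs s B₂ (s' ∩ B₂ ∩ (t' ∩ B₂))) *
          (prob pr (coreLevel arcs s B₁ (s' ∩ B₁ ∪ t' ∩ B₁)) *
            prob pr (coreLevel arcs s B₂ (s' ∩ B₂ ∪ t' ∩ B₂))) := by ring
  have hA0 : ∀ X, 0 ≤ A X := fun X => prob_nonneg hp _
  have hAmono : ∀ X Y : Finset V, X ⊆ Y → A Y ≤ A X := by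
    intro X Y hXY
    simp only [hA]
    apply prob_mono hp
    intro ω hω v hv
    exact hω v (Finset.insert_subset_insert s hXY hv)
  have hAlsm : ∀ X Y : Finset V, A X * A Y ≤ A (X ∩ Y) * A (X ∪ Y) := by
    intro X Y
    have hh := vdBKC_rev pr hp (sameEnds_coreOff (C := insert a U) hS) t ∅ ∅
      (insert s X) (insert s Y)
    have hi : insert s X ∩ insert s Y = insert s (X ∩ Y) := (Finset.insert_inter_distrib X Y s).symm
    have hun : insert s X ∪ insert s Y = insert s (X ∪ Y) := (Finset.insert_union_distrib s X Y).symm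
    rw [hi, hun] at hh
    simp only [hA, coreAvoidEvent]
    simpa only [Finset.notMem_empty, false_imp_iff, implies_true, Set.setOf_true, Set.univ_inter,
      Finset.empty_union] using hh
  exact orTail_functional_nonneg U ν A p q a w (pr cρ) (pr cτ) haU hwU (hp.nonneg cρ)
    (hp.le_one cρ) (hp.nonneg cτ) (hp.le_one cτ) hν0 hνlsm hA0 hAlsm hAmono

/-- **COROLLARY (two out-tree branches).**  If the two branches of an OR-tail core are out-trees
(`TreeCore`, e.g. directed routes of any length, stars, any rooted trees), their cluster laws are
log-supermodular and row 2′DARC holds at `a → w` for the markers `p, q` at every head.  In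
particular every directed two-route core `s → p₁ → … → p_k → a ← q_l ← … ← q₁ ← s` with the
markers `p = p_k`, `q = q_l` adjacent to the tail. -/
theorem darc_of_orTailTrees (pr : E → R) (hp : IsProbVec pr) (hS : SameEnds arcs)
    (h : OrTailCore arcs s B₁ B₂ p q a cρ cτ)
    {c₁ : V → E} {par₁ : V → V} {rk₁ : V → ℕ} (h₁ : TreeCore arcs s B₁ c₁ par₁ rk₁)
    {c₂ : V → E} {par₂ : V → V} {rk₂ : V → ℕ} (h₂ : TreeCore arcs s B₂ c₂ par₂ rk₂)
    {t : V} (htC : t ∉ insert a (B₁ ∪ B₂)) (hts : t ≠ s) (hws : w ≠ s)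
    (hwC : w ∉ insert a (B₁ ∪ B₂)) :
    DARC pr arcs s {t} p q a w :=
  darc_of_orTailCore pr hp hS h (h₁.coreLevel_lsm pr hp) (h₂.coreLevel_lsm pr hp) htC hts hws hwC

end OrTailMain

end Summit.Ventures.PercRepro2.Coin
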